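import Summits.QuantumFields.YangMills.Theorems.LuscherReductionTwistedTraceScalingRecordWeightConj
import HarnessLib

/-!
# A gauge average of a function invariant under constant gauge transformations is an average over BASED gauge transformations (`g(0) = 1`, product Haar)
# (lane A of S-BASE, crux `TwistedTraceScaling` stmt-QuantumFields-20203, C4 INNER; design note `pub/ym-fleet/ym-luscher-20007-p1/COARSE-DESIGN.md` §23.8 (N2))

By `…RecordWeightConj` the integrand `g ↦ recordWeight(U^g)` of the Faddeev–Popov weight `N(U)` is invariant under `g ↦ c·g` (constant `c`).  THIS FILE: for any bounded
measurable `F : (sites → SU(2)) → ℝ` with `F(c·g) = F(g)`: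
★★ `integral_gaugeMeasure_eq_based`: `∫ F dg = ∫ F(basedExt h) dh`, the right-hand side over `h : {x ≠ 0} → SU(2)` with PRODUCT Haar probability and `basedExt h` the based
gauge transformation (`1` at the origin, `h` elsewhere).  (Split the product Haar measure at the origin, `MeasurableEquiv.piEquivPiSubtypeProd`; for fixed origin value `a` use
`F(g) = F(a⁻¹·g)` and the left invariance of the product Haar measure of the other sites; the origin factor is a probability measure.)
★★ `gaugeAvg_recordWeight_eq_based`: `N(U) = ∫ recordWeight(U^{basedExt h}) dh` — the constant gauge modes are gone EXACTLY, and the remaining integral is over a PRODUCT of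
`|sites| − 1` Haar spheres, for which `…GaugeGroupGnChart` / `…GaugeGroupGaussianSandwich` give flat gnomonic coordinates and the Gaussian sandwich: the measure side of (N2).
HONEST FRAMING: measure bookkeeping for a stub of a child of the CONDITIONAL reduction route R2b1; no spectral claim; C4 OPEN; not a gap, not Clay.
-/

set_option autoImplicit false

noncomputable section

open MeasureTheory Real
open scoped BigOperators
open Literature.MathematicalPhysics.QuantumFieldTheory
open Literature.MathematicalPhysics.QuantumLattice

namespace Summit.QuantumFields.YangMills.Theorems.FemtoTransferGap.TwoLattice.ConstTube

open Summit.QuantumFields.YangMills.Theorems.FemtoTransferGap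
open Summit.QuantumFields.YangMills.Theorems.FemtoTransferGap.TwoLattice.Avg

variable (L : ℕ) [NeZero L]

/-- The nonzero sites. [folklore] -/
abbrev NzSite : Type := {x : Site 3 L // ¬x = 0}

/-- The product Haar probability on based gauge transformations `{x ≠ 0} → SU(2)`. [folklore] -/
abbrev basedMeasure : Measure (NzSite L → SU2) := Measure.pi fun _ => haarProbability SU2

/-- The based gauge transformation with values `h` off the origin and `1` at the origin. [folklore] -/
def basedExt (h : NzSite L → SU2) : Site 3 L → SU2 := fun x => if hx : x = 0 then 1 else h ⟨x, hx⟩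

omit [NeZero L] in
/-- `basedExt h 0 = 1`. [folklore] -/
@[simp] theorem basedExt_zero (h : NzSite L → SU2) : basedExt L h 0 = 1 := by simp [basedExt]

omit [NeZero L] in
/-- `basedExt h x = h x` off the origin. [folklore] -/
theorem basedExt_of_ne (h : NzSite L → SU2) {x : Site 3 L} (hx : ¬x = 0) : basedExt L h x = h ⟨x, hx⟩ := by simp [basedExt, hx]

omit [NeZero L] in
/-- `basedExt` is measurable. [folklore] -/
theorem measurable_basedExt : Measurable (basedExt L) := by
  refine measurable_pi_lambda _ fun x => ?_
  by_cases hx : x = 0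
  · simp only [basedExt, hx]; exact measurable_const
  · simp only [basedExt, hx]; exact measurable_pi_apply _

omit [NeZero L] in
/-- The split of a gauge transformation at the origin, re-assembled and left-translated by the inverse origin value, is a based gauge transformation. [folklore] -/
theorem inv_mul_split_symm (a : {x : Site 3 L // x = 0} → SU2) (b : NzSite L → SU2) :
    (fun x => (a ⟨0, rfl⟩)⁻¹ * (MeasurableEquiv.piEquivPiSubtypeProd (fun _ : Site 3 L => SU2) (fun x => x = 0)).symm (a, b) x) =
      basedExt L (fun y => (a ⟨0, rfl⟩)⁻¹ * b y) := by
  funext x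
  by_cases hx : x = 0
  · subst hx
    simp [basedExt, MeasurableEquiv.piEquivPiSubtypeProd, Equiv.piEquivPiSubtypeProd]
  · simp [basedExt, hx, MeasurableEquiv.piEquivPiSubtypeProd, Equiv.piEquivPiSubtypeProd]

/-- ★★ **A GAUGE AVERAGE OF A CONSTANT-INVARIANT FUNCTION IS A BASED AVERAGE**: `∫ F dg = ∫ F(basedExt h) dh`. [folklore] -/
theorem integral_gaugeMeasure_eq_based {F : (Site 3 L → SU2) → ℝ} (hF : Measurable F) {C : ℝ} (hC : ∀ g, |F g| ≤ C)
    (hinv : ∀ (c : SU2) (g : Site 3 L → SU2), F (fun x => c * g x) = F g) :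
    ∫ g, F g ∂gaugeMeasure L = ∫ h, F (basedExt L h) ∂basedMeasure L := by
  set e := MeasurableEquiv.piEquivPiSubtypeProd (fun _ : Site 3 L => SU2) (fun x => x = 0) with he
  have hmp := measurePreserving_piEquivPiSubtypeProd (fun _ : Site 3 L => haarProbability SU2) (fun x => x = 0)
  -- transport to the product
  have h1 := hmp.integral_comp' (fun p => F (e.symm p))
  simp only [← he, MeasurableEquiv.symm_apply_apply] at h1
  rw [show gaugeMeasure L = Measure.pi (fun _ : Site 3 L => haarProbability SU2) from rfl, h1]
  -- Fubini
  rw [integral_prod (fun p => F (e.symm p)) (Integrable.mono' (integrable_const C) (hF.comp e.symm.measurable).aestronglyMeasurable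
    (ae_of_all _ fun p => by rw [Real.norm_eq_abs]; exact hC _))]
  -- the inner integral does not depend on the origin value
  have hinner : ∀ a : {x : Site 3 L // x = 0} → SU2, ∫ b, F (e.symm (a, b)) ∂basedMeasure L = ∫ h, F (basedExt L h) ∂basedMeasure L := fun a => by
    have hrew : ∀ b : NzSite L → SU2, F (e.symm (a, b)) = F (basedExt L ((fun _ => (a ⟨0, rfl⟩)⁻¹) * b)) := fun b => by
      rw [← hinv (a ⟨0, rfl⟩)⁻¹ (e.symm (a, b)), he, inv_mul_split_symm]; rfl
    simp_rw [hrew]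
    exact integral_mul_left_eq_self (μ := basedMeasure L) (fun b => F (basedExt L b)) (fun _ => (a ⟨0, rfl⟩)⁻¹)
  simp_rw [hinner]
  rw [integral_const, smul_eq_mul, probReal_univ, one_mul]

/-- The record weight is measurable. [folklore] -/
theorem measurable_recordWeight (δ δg : ℝ → ℝ) (β : ℝ) : Measurable (recordWeight L δ δg β) := by
  unfold recordWeight
  exact (measurable_const.indicator (measurableSet_fatTube L δ β)).mul (measurable_gaussFactor L δg β)

/-- `0 ≤ recordWeight ≤ 1`. [folklore] -/
theorem recordWeight_mem_Icc (δ δg : ℝ → ℝ) (β : ℝ) (U : GaugeConfig 3 L SU2) : recordWeight L δ δg β U ∈ Set.Icc (0 : ℝ) 1 := by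
  unfold recordWeight
  have hind0 : 0 ≤ (fatTube L δ β).indicator (fun _ => (1 : ℝ)) U := Set.indicator_nonneg (fun _ _ => zero_le_one) U
  have hind1 : (fatTube L δ β).indicator (fun _ => (1 : ℝ)) U ≤ 1 := Set.indicator_le_self' (fun _ _ => zero_le_one) U
  have hexp0 : 0 ≤ Real.exp (-(gaugeCoordSq L U / δg β ^ 2)) := (Real.exp_pos _).le
  have hexp1 := gaussFactor_le_one L δg β U
  exact ⟨mul_nonneg hind0 hexp0, by nlinarith⟩

/-- ★★ **THE FADDEEV–POPOV WEIGHT IS A BASED AVERAGE**: `gaugeAvg(recordWeight)(U) = ∫ recordWeight(U^{basedExt h}) dh`. [folklore] -/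
theorem gaugeAvg_recordWeight_eq_based (δ δg : ℝ → ℝ) (β : ℝ) (U : GaugeConfig 3 L SU2) :
    gaugeAvg (recordWeight L δ δg β) U = ∫ h, recordWeight L δ δg β (gaugeTransform (basedExt L h) U) ∂basedMeasure L := by
  unfold gaugeAvg
  refine integral_gaugeMeasure_eq_based L (F := fun g => recordWeight L δ δg β (gaugeTransform g U))
    (measurable_comp_gaugeTransform_left (measurable_recordWeight L δ δg β) U) (C := 1)
    (fun g => ?_) (fun c g => ?_)
  · obtain ⟨h0, h1⟩ := recordWeight_mem_Icc L δ δg β (gaugeTransform g U)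
    rw [abs_of_nonneg h0]; exact h1
  · have h : gaugeTransform (fun x => c * g x) U = gaugeTransform (fun _ => c) (gaugeTransform g U) := by
      funext e; simp [gaugeTransform, mul_assoc]
    rw [h, recordWeight_conj]

end Summit.QuantumFields.YangMills.Theorems.FemtoTransferGap.TwoLattice.ConstTube

end
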